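import Summits.CriticalPhenomena.PercolationContinuityZ3.Theorems.PercNearOneGluingNoHeavyLowerTailStarSetMixedForestLonely
import Summits.CriticalPhenomena.PercolationContinuityZ3.Theorems.PercNearOneGluingNoHeavyLowerTailStarSetPairRowCertificate
import HarnessLib

/-!
# `NoHeavyLowerTail` (stmt-CriticalPhenomena-4575) — mixed (forest + chords) certificate: the LONELY side (pointwise)

Support file (prover `prim-gen-swap` gen 9; `--supports stmt-CriticalPhenomena-4575`).  No definitions, no named facts, no sorries.

Seat memo MWF-CERT.md §3: classes `Fin (Mf + Mc)` of a two-port star multigraph, the first `Mf` a class forest in leaf-peeling order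
(champion rows with the nested coefficients `c_I`), the last `Mc` arbitrary ("chords", relay-pair rows with multipliers `D_K = Θ_K·Zfar_K`).
Pointwise in the configuration `ξ` off the stars, the lonely word is dominated by the two budgets:

* `StarSet.mixed_lonely_le` —
  `Σ_S W(S)·1[D₂(S)] ≤ Σ_{I : P_I ∉ X} c_I·Σ_S W(S)·1[P_I light in ξ ∪ L_S] + Σ_K D_K·Σ_S W(S)·1[R_K lonely in ξ ∪ L_S]`,
  for any set `X` of ports each of which, whenever it is a port of a forest class, carries a third relay in `ξ` (dead ports).
Ingredients: `StarSet.mixed_forestLonely_le` (forest part, per chord pattern), `StarSet.pair_lonely_links` (chord part).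
-/

noncomputable section

namespace Summit.CriticalPhenomena.PercolationContinuityZ3.Theorems

open MeasureTheory Set Literature.Probability.LatticeModels Literature.Probability.Percolation
open scoped Classical BigOperators

variable {n Mf Mc : ℕ}

namespace StarSet

/-- **Mixed certificate, lonely side.**  See the file header. [MWF-CERT.md §3] -/
theorem mixed_lonely_le (w : Sym2 (Fin n) → unitInterval) (A : Finset (Fin n)) {m : ℕ}
    (s p p' : Fin m → Fin n) (cls : Fin m → Fin (Mf + Mc)) (P P' : Fin (Mf + Mc) → Fin n)
    (c : Fin n) (j : ℕ) (hj : j ≤ 2)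
    (hPA : ∀ κ, P κ ∈ A) (hP'A : ∀ κ, P' κ ∈ A) (hPP' : ∀ κ, P κ ≠ P' κ)
    (hnopar : ∀ I K : Fin (Mf + Mc), I ≠ K → ¬ ((P K = P I ∨ P K = P' I) ∧ (P' K = P I ∨ P' K = P' I)))
    (hforest : ∀ K I : Fin Mf, K < I → P' (Fin.castAdd Mc K) ≠ P (Fin.castAdd Mc I) ∧ P' (Fin.castAdd Mc K) ≠ P' (Fin.castAdd Mc I))
    (ω : BondConfig (Fin n)) (X : Finset (Fin n))
    (hX : ∀ I : Fin Mf, (P (Fin.castAdd Mc I) ∈ X ∨ P' (Fin.castAdd Mc I) ∈ X) →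
      ∃ a ∈ A, a ≠ P (Fin.castAdd Mc I) ∧ a ≠ P' (Fin.castAdd Mc I) ∧
        ((openGraph (ω ∩ {e | ∀ v ∈ Finset.univ.image s, v ∉ e})).Reachable a (P (Fin.castAdd Mc I)) ∨
          (openGraph (ω ∩ {e | ∀ v ∈ Finset.univ.image s, v ∉ e})).Reachable a (P' (Fin.castAdd Mc I)))) :
    ∑ S ∈ (Finset.univ : Finset (Fin (Mf + Mc))).powerset,
        ((∏ κ ∈ S, (1 - ∏ i ∈ Finset.univ.filter (fun i => cls i = κ), (1 - (w s(s i, p i) : ℝ) * w s(s i, p' i)))) *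
          ∏ κ ∈ Finset.univ \ S, ∏ i ∈ Finset.univ.filter (fun i => cls i = κ), (1 - (w s(s i, p i) : ℝ) * w s(s i, p' i))) *
        DecisionTree.ind {ω' : BondConfig (Fin n) |
            (∀ u ∈ S.image P ∪ S.image P', ¬ (openGraph (ω' ∩ {e | ∀ v ∈ Finset.univ.image s, v ∉ e})).Reachable c u) ∧
            1 ≤ (A.filter fun z => ∃ u ∈ S.image P ∪ S.image P',
              (openGraph (ω' ∩ {e | ∀ v ∈ Finset.univ.image s, v ∉ e})).Reachable u z).card ∧
            (A.filter fun z => ∃ u ∈ S.image P ∪ S.image P',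
              (openGraph (ω' ∩ {e | ∀ v ∈ Finset.univ.image s, v ∉ e})).Reachable u z).card ≤ j} ω ≤
      ∑ I ∈ (Finset.univ : Finset (Fin Mf)).filter (fun I => P (Fin.castAdd Mc I) ∉ X),
        ((1 - ∏ i ∈ Finset.univ.filter (fun i => cls i = Fin.castAdd Mc I), (1 - (w s(s i, p i) : ℝ) * w s(s i, p' i))) *
          ∏ K ∈ Finset.univ.filter (· < I), ∏ i ∈ Finset.univ.filter (fun i => cls i = Fin.castAdd Mc K), (1 - (w s(s i, p i) : ℝ) * w s(s i, p' i))) *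
        ∑ S ∈ (Finset.univ : Finset (Fin (Mf + Mc))).powerset,
          ((∏ κ ∈ S, (1 - ∏ i ∈ Finset.univ.filter (fun i => cls i = κ), (1 - (w s(s i, p i) : ℝ) * w s(s i, p' i)))) *
            ∏ κ ∈ Finset.univ \ S, ∏ i ∈ Finset.univ.filter (fun i => cls i = κ), (1 - (w s(s i, p i) : ℝ) * w s(s i, p' i))) *
          DecisionTree.ind {ω' : BondConfig (Fin n) |
            (A.filter fun z => (openGraph ((ω' ∩ {e | ∀ v ∈ Finset.univ.image s, v ∉ e}) ∪
              ↑(S.image fun κ => (s(P κ, P' κ) : Sym2 (Fin n))))).Reachable (P (Fin.castAdd Mc I)) z).card ≤ j} ω +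
      ∑ K : Fin Mc, ((1 - ∏ i ∈ Finset.univ.filter (fun i => cls i = Fin.natAdd Mf K), (1 - (w s(s i, p i) : ℝ) * w s(s i, p' i))) *
          ∏ κ' ∈ Finset.univ.filter (fun κ' => ¬ (P κ' = P (Fin.natAdd Mf K) ∨ P κ' = P' (Fin.natAdd Mf K) ∨
              P' κ' = P (Fin.natAdd Mf K) ∨ P' κ' = P' (Fin.natAdd Mf K))),
            ∏ i ∈ Finset.univ.filter (fun i => cls i = κ'), (1 - (w s(s i, p i) : ℝ) * w s(s i, p' i))) *
        ∑ S ∈ (Finset.univ : Finset (Fin (Mf + Mc))).powerset,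
          ((∏ κ ∈ S, (1 - ∏ i ∈ Finset.univ.filter (fun i => cls i = κ), (1 - (w s(s i, p i) : ℝ) * w s(s i, p' i)))) *
            ∏ κ ∈ Finset.univ \ S, ∏ i ∈ Finset.univ.filter (fun i => cls i = κ), (1 - (w s(s i, p i) : ℝ) * w s(s i, p' i))) *
          DecisionTree.ind {ω' : BondConfig (Fin n) |
            (∀ u ∈ ({Fin.natAdd Mf K} : Finset (Fin (Mf + Mc))).image P ∪ ({Fin.natAdd Mf K} : Finset (Fin (Mf + Mc))).image P',
              ¬ (openGraph ((ω' ∩ {e | ∀ v ∈ Finset.univ.image s, v ∉ e}) ∪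
                ↑(S.image fun κ => (s(P κ, P' κ) : Sym2 (Fin n))))).Reachable c u) ∧
            1 ≤ (A.filter fun z => ∃ u ∈ ({Fin.natAdd Mf K} : Finset (Fin (Mf + Mc))).image P ∪
                ({Fin.natAdd Mf K} : Finset (Fin (Mf + Mc))).image P',
              (openGraph ((ω' ∩ {e | ∀ v ∈ Finset.univ.image s, v ∉ e}) ∪
                ↑(S.image fun κ => (s(P κ, P' κ) : Sym2 (Fin n))))).Reachable u z).card ∧
            (A.filter fun z => ∃ u ∈ ({Fin.natAdd Mf K} : Finset (Fin (Mf + Mc))).image P ∪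
                ({Fin.natAdd Mf K} : Finset (Fin (Mf + Mc))).image P',
              (openGraph ((ω' ∩ {e | ∀ v ∈ Finset.univ.image s, v ∉ e}) ∪
                ↑(S.image fun κ => (s(P κ, P' κ) : Sym2 (Fin n))))).Reachable u z).card ≤ j} ω := by
  -- weights
  set θ : Fin m → ℝ := fun i => (w s(s i, p i) : ℝ) * w s(s i, p' i) with hθ
  have hθ0 : ∀ i, 0 ≤ θ i := fun i => mul_nonneg (w _).2.1 (w _).2.1
  have hθ1 : ∀ i, θ i ≤ 1 := fun i => mul_le_one₀ (w _).2.2 (w _).2.1 (w _).2.2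
  set uu : Fin (Mf + Mc) → ℝ := fun κ => ∏ i ∈ Finset.univ.filter (fun i => cls i = κ), (1 - θ i) with huu
  have huu0 : ∀ κ, 0 ≤ uu κ := fun κ => Finset.prod_nonneg fun i _ => sub_nonneg.2 (hθ1 i)
  have huu1 : ∀ κ, uu κ ≤ 1 := fun κ => Finset.prod_le_one (fun i _ => sub_nonneg.2 (hθ1 i)) fun i _ => sub_le_self _ (hθ0 i)
  set Θ : Fin (Mf + Mc) → ℝ := fun κ => 1 - uu κ with hΘ
  have hΘ0 : ∀ κ, 0 ≤ Θ κ := fun κ => sub_nonneg.2 (huu1 κ)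
  have hΘ1 : ∀ κ, Θ κ ≤ 1 := fun κ => sub_le_self _ (huu0 κ)
  have hΘuu : ∀ κ, 1 - Θ κ = uu κ := fun κ => by simp only [hΘ, sub_sub_cancel]
  set W : Finset (Fin (Mf + Mc)) → ℝ := fun S => (∏ κ ∈ S, Θ κ) * ∏ κ ∈ Finset.univ \ S, uu κ with hW
  have hWnn : ∀ S, 0 ≤ W S := fun S => mul_nonneg (Finset.prod_nonneg fun κ _ => hΘ0 κ) (Finset.prod_nonneg fun κ _ => huu0 κ)
  have hWΘ : ∀ S, (∏ κ ∈ S, Θ κ) * ∏ κ ∈ Finset.univ \ S, (1 - Θ κ) = W S := fun S => by simp only [hW, hΘuu]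
  set touch : Fin (Mf + Mc) → Fin (Mf + Mc) → Prop := fun K' K => P K' = P K ∨ P K' = P' K ∨ P' K' = P K ∨ P' K' = P' K with htouch
  set D : Fin Mc → ℝ := fun K => Θ (Fin.natAdd Mf K) * ∏ κ' ∈ Finset.univ.filter (fun κ' => ¬ touch κ' (Fin.natAdd Mf K)), uu κ' with hD
  have hDnn : ∀ K, 0 ≤ D K := fun K => mul_nonneg (hΘ0 _) (Finset.prod_nonneg fun κ' _ => huu0 κ')
  set cfF : Fin Mf → ℝ := fun I => Θ (Fin.castAdd Mc I) * ∏ K ∈ Finset.univ.filter (· < I), uu (Fin.castAdd Mc K) with hcfF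
  have hcfFnn : ∀ I, 0 ≤ cfF I := fun I => mul_nonneg (hΘ0 _) (Finset.prod_nonneg fun K _ => huu0 _)
  -- cylinder sums in the `uu`-form
  have hcylU : ∀ Cl : Finset (Fin (Mf + Mc)), ∑ S ∈ (Finset.univ : Finset (Fin (Mf + Mc))).powerset,
      W S * (if (∀ K ∈ Cl, K ∉ S) then (1 : ℝ) else 0) = ∏ K ∈ Cl, uu K := by
    intro Cl
    have h := cylinder_sum_closed Θ Cl
    simp only [hΘuu] at h
    refine Eq.trans (Finset.sum_congr rfl fun S _ => ?_) h
    by_cases hS : ∀ K ∈ Cl, K ∉ S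
    · rw [if_pos hS, if_pos hS]
    · rw [if_neg hS, if_neg hS]
  set ξ : BondConfig (Fin n) := ω ∩ {e | ∀ v ∈ Finset.univ.image s, v ∉ e} with hξ
  set RK : Fin (Mf + Mc) → Finset (Fin n) := fun κ => ({κ} : Finset (Fin (Mf + Mc))).image P ∪ ({κ} : Finset (Fin (Mf + Mc))).image P' with hRK
  set ℓ : Fin Mc → Finset (Fin (Mf + Mc)) → Set (BondConfig (Fin n)) := fun K S => {ω' |
    (∀ u ∈ RK (Fin.natAdd Mf K), ¬ (openGraph ((ω' ∩ {e | ∀ v ∈ Finset.univ.image s, v ∉ e}) ∪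
      ↑(S.image fun κ => (s(P κ, P' κ) : Sym2 (Fin n))))).Reachable c u) ∧
    1 ≤ (A.filter fun z => ∃ u ∈ RK (Fin.natAdd Mf K),
      (openGraph ((ω' ∩ {e | ∀ v ∈ Finset.univ.image s, v ∉ e}) ∪ ↑(S.image fun κ => (s(P κ, P' κ) : Sym2 (Fin n))))).Reachable u z).card ∧
    (A.filter fun z => ∃ u ∈ RK (Fin.natAdd Mf K),
      (openGraph ((ω' ∩ {e | ∀ v ∈ Finset.univ.image s, v ∉ e}) ∪ ↑(S.image fun κ => (s(P κ, P' κ) : Sym2 (Fin n))))).Reachable u z).card ≤ j}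
    with hℓ
  set SpF : Fin Mf → Finset (Fin (Mf + Mc)) → Set (BondConfig (Fin n)) := fun I S => {ω' |
    (A.filter fun z => (openGraph ((ω' ∩ {e | ∀ v ∈ Finset.univ.image s, v ∉ e}) ∪
      ↑(S.image fun κ => (s(P κ, P' κ) : Sym2 (Fin n))))).Reachable (P (Fin.castAdd Mc I)) z).card ≤ j} with hSpF
  set D₂ : Finset (Fin (Mf + Mc)) → Set (BondConfig (Fin n)) := fun S => {ω' |
    (∀ u ∈ S.image P ∪ S.image P', ¬ (openGraph (ω' ∩ {e | ∀ v ∈ Finset.univ.image s, v ∉ e})).Reachable c u) ∧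
      1 ≤ (A.filter fun z => ∃ u ∈ S.image P ∪ S.image P',
        (openGraph (ω' ∩ {e | ∀ v ∈ Finset.univ.image s, v ∉ e})).Reachable u z).card ∧
      (A.filter fun z => ∃ u ∈ S.image P ∪ S.image P',
        (openGraph (ω' ∩ {e | ∀ v ∈ Finset.univ.image s, v ∉ e})).Reachable u z).card ≤ j} with hD₂
  set PS : Finset (Finset (Fin (Mf + Mc))) := (Finset.univ : Finset (Fin (Mf + Mc))).powerset with hPS
  change ∑ S ∈ PS, W S * DecisionTree.ind (D₂ S) ω ≤
    ∑ I ∈ Finset.univ.filter (fun I => P (Fin.castAdd Mc I) ∉ X), cfF I * ∑ S ∈ PS, W S * DecisionTree.ind (SpF I S) ω +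
      ∑ K, D K * ∑ S ∈ PS, W S * DecisionTree.ind (ℓ K S) ω
  -- (1) only singletons are lonely
  have hD₂single : ∀ S, (∀ κ, S ≠ {κ}) → DecisionTree.ind (D₂ S) ω = 0 := by
    intro S hS
    refine DecisionTree.ind_of_not_mem fun hω => ?_
    simp only [hD₂, mem_setOf_eq] at hω
    obtain ⟨κ, rfl⟩ := portPattern_lonely_singleton' ξ A P P' S j hj hPA hP'A hPP'
      (fun I _ K _ hIK => hnopar I K hIK) (hω.2.1.trans_eq (card_filter_congr fun _ _ => Iff.rfl))
      ((card_filter_congr fun _ _ => Iff.rfl).trans_le hω.2.2)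
    exact hS κ rfl
  have hlonelySum : ∑ S ∈ PS, W S * DecisionTree.ind (D₂ S) ω =
      ∑ I : Fin Mf, W {Fin.castAdd Mc I} * DecisionTree.ind (D₂ {Fin.castAdd Mc I}) ω +
        ∑ K : Fin Mc, W {Fin.natAdd Mf K} * DecisionTree.ind (D₂ {Fin.natAdd Mf K}) ω := by
    rw [sum_powerset_eq_sum_singletons (fun S => W S * DecisionTree.ind (D₂ S) ω) (fun S hS => by rw [hD₂single S hS, mul_zero]),
      Fin.sum_univ_add]
  -- (2) chord part: the pair-row identity
  have hWK : ∀ κ, W {κ} = (Θ κ * ∏ κ' ∈ Finset.univ.filter (fun κ' => ¬ touch κ' κ), uu κ') *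
      ∏ κ' ∈ Finset.univ.filter (fun κ' => touch κ' κ ∧ κ' ≠ κ), uu κ' := by
    intro κ
    have hsplit : Finset.univ \ ({κ} : Finset (Fin (Mf + Mc))) =
        Finset.univ.filter (fun κ' => ¬ touch κ' κ) ∪ Finset.univ.filter (fun κ' => touch κ' κ ∧ κ' ≠ κ) := by
      ext κ'
      simp only [Finset.mem_sdiff, Finset.mem_univ, Finset.mem_singleton, true_and, Finset.mem_union, Finset.mem_filter]
      constructor
      · intro hne
        by_cases h : touch κ' κ
        · exact Or.inr ⟨h, hne⟩
        · exact Or.inl h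
      · rintro (h | ⟨_, h⟩)
        · intro hK; apply h; rw [hK]; exact Or.inl rfl
        · exact h
    have hdisj : Disjoint (Finset.univ.filter (fun κ' => ¬ touch κ' κ)) (Finset.univ.filter (fun κ' => touch κ' κ ∧ κ' ≠ κ)) := by
      rw [Finset.disjoint_filter]; intro κ' _ h h'; exact h h'.1
    simp only [hW, Finset.prod_singleton]
    rw [hsplit, Finset.prod_union hdisj]
    ring
  have hpay : ∀ K : Fin Mc, W {Fin.natAdd Mf K} * DecisionTree.ind (D₂ {Fin.natAdd Mf K}) ω ≤
      D K * ∑ S ∈ PS, W S * DecisionTree.ind (ℓ K S) ω := by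
    intro K
    by_cases hω : ω ∈ D₂ {Fin.natAdd Mf K}
    · have hmem := hω
      simp only [hD₂, mem_setOf_eq] at hω
      obtain ⟨hsep, -, hl⟩ := hω
      have hcyl := hcylU (Finset.univ.filter (fun κ' => touch κ' (Fin.natAdd Mf K) ∧ κ' ≠ Fin.natAdd Mf K))
      have hge : ∑ S ∈ PS, W S * (if (∀ κ' ∈ Finset.univ.filter (fun κ' => touch κ' (Fin.natAdd Mf K) ∧ κ' ≠ Fin.natAdd Mf K), κ' ∉ S)
            then (1 : ℝ) else 0) ≤ ∑ S ∈ PS, W S * DecisionTree.ind (ℓ K S) ω := by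
        refine Finset.sum_le_sum fun S _ => mul_le_mul_of_nonneg_left ?_ (hWnn S)
        split_ifs with hfarS
        · refine le_of_eq (DecisionTree.ind_of_mem ?_).symm
          have hfar' : ∀ I ∈ S, I ≠ Fin.natAdd Mf K → ¬ touch I (Fin.natAdd Mf K) := fun I hI hIK h =>
            hfarS I (Finset.mem_filter.2 ⟨Finset.mem_univ _, h, hIK⟩) hI
          have h3 := pair_lonely_links ξ A P P' (Fin.natAdd Mf K) S c j hj hPA hP'A hPP' hfar' hsep
            ((card_filter_congr fun _ _ => Iff.rfl).trans_le hl)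
          simp only [hℓ, hRK, mem_setOf_eq]
          exact ⟨h3.1, h3.2.1.trans_eq (card_filter_congr fun _ _ => Iff.rfl), (card_filter_congr fun _ _ => Iff.rfl).trans_le h3.2.2⟩
        · exact DecisionTree.ind_nonneg _ _
      rw [hcyl] at hge
      rw [DecisionTree.ind_of_mem hmem, mul_one, hWK]
      exact mul_le_mul_of_nonneg_left hge (hDnn K)
    · rw [DecisionTree.ind_of_not_mem hω, mul_zero]
      exact mul_nonneg (hDnn K) (Finset.sum_nonneg fun S _ => mul_nonneg (hWnn S) (DecisionTree.ind_nonneg _ _))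
  -- (3) forest part
  have hXbase : ∀ (I : Fin Mf) (U : Finset (Fin Mc)), (P (Fin.castAdd Mc I) ∈ X ∨ P' (Fin.castAdd Mc I) ∈ X) →
      ¬ (1 ≤ (A.filter fun z => ∃ u ∈ ({Fin.castAdd Mc I} : Finset (Fin (Mf + Mc))).image P ∪
              ({Fin.castAdd Mc I} : Finset (Fin (Mf + Mc))).image P',
            (openGraph (ξ ∪ ↑(U.image fun K => (s(P (Fin.natAdd Mf K), P' (Fin.natAdd Mf K)) : Sym2 (Fin n))))).Reachable u z).card ∧
        (A.filter fun z => ∃ u ∈ ({Fin.castAdd Mc I} : Finset (Fin (Mf + Mc))).image P ∪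
              ({Fin.castAdd Mc I} : Finset (Fin (Mf + Mc))).image P',
            (openGraph (ξ ∪ ↑(U.image fun K => (s(P (Fin.natAdd Mf K), P' (Fin.natAdd Mf K)) : Sym2 (Fin n))))).Reachable u z).card ≤ j) := by
    intro I U hI h
    obtain ⟨a, haA, ha1, ha2, hareach⟩ := hX I hI
    set Λ : Set (Sym2 (Fin n)) := ↑(U.image fun K => (s(P (Fin.natAdd Mf K), P' (Fin.natAdd Mf K)) : Sym2 (Fin n))) with hΛ
    have hmemR : ∀ u, u ∈ ({Fin.castAdd Mc I} : Finset (Fin (Mf + Mc))).image P ∪ ({Fin.castAdd Mc I} : Finset (Fin (Mf + Mc))).image P' ↔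
        u = P (Fin.castAdd Mc I) ∨ u = P' (Fin.castAdd Mc I) := by
      intro u; simp only [Finset.image_singleton, Finset.mem_union, Finset.mem_singleton]
    have hsub : ({P (Fin.castAdd Mc I), P' (Fin.castAdd Mc I), a} : Finset (Fin n)) ⊆
        A.filter fun z => ∃ u ∈ ({Fin.castAdd Mc I} : Finset (Fin (Mf + Mc))).image P ∪ ({Fin.castAdd Mc I} : Finset (Fin (Mf + Mc))).image P',
          (openGraph (ξ ∪ Λ)).Reachable u z := by
      intro z hz
      simp only [Finset.mem_insert, Finset.mem_singleton] at hz
      rw [Finset.mem_filter]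
      rcases hz with rfl | rfl | rfl
      · exact ⟨hPA _, P (Fin.castAdd Mc I), (hmemR _).2 (Or.inl rfl), SimpleGraph.Reachable.refl _⟩
      · exact ⟨hP'A _, P' (Fin.castAdd Mc I), (hmemR _).2 (Or.inr rfl), SimpleGraph.Reachable.refl _⟩
      · rcases hareach with hr | hr
        · exact ⟨haA, P (Fin.castAdd Mc I), (hmemR _).2 (Or.inl rfl), (reachable_mono_union ξ Λ hr).symm⟩
        · exact ⟨haA, P' (Fin.castAdd Mc I), (hmemR _).2 (Or.inr rfl), (reachable_mono_union ξ Λ hr).symm⟩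
    have hcard : ({P (Fin.castAdd Mc I), P' (Fin.castAdd Mc I), a} : Finset (Fin n)).card = 3 := by
      rw [Finset.card_insert_of_notMem, Finset.card_pair ha2.symm]
      simp only [Finset.mem_insert, Finset.mem_singleton, not_or]
      exact ⟨hPP' _, ha1.symm⟩
    have := Finset.card_le_card hsub
    omega
  have hforestPart : ∑ I : Fin Mf, W {Fin.castAdd Mc I} * DecisionTree.ind (D₂ {Fin.castAdd Mc I}) ω ≤
      ∑ I ∈ Finset.univ.filter (fun I => P (Fin.castAdd Mc I) ∉ X), cfF I * ∑ S ∈ PS, W S * DecisionTree.ind (SpF I S) ω := by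
    have hbrick := mixed_forestLonely_le A P P' Θ hΘ0 hΘ1 j hj hPA hP'A hPP' hforest ξ X hXbase
    simp only [hΘuu] at hbrick
    refine le_trans (Finset.sum_le_sum fun I _ => ?_) (le_trans hbrick (le_of_eq ?_))
    · -- the lonely cell with `c`-separation is inside the `c`-free lonely cell
      rw [← hWΘ {Fin.castAdd Mc I}]
      simp only [hΘuu]
      refine mul_le_mul_of_nonneg_left ?_ ?_
      · by_cases hω : ω ∈ D₂ {Fin.castAdd Mc I}
        · rw [DecisionTree.ind_of_mem hω, DecisionTree.ind_of_mem]
          simp only [hD₂, mem_setOf_eq] at hω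
          simp only [mem_setOf_eq]
          exact ⟨hω.2.1.trans_eq (card_filter_congr fun _ _ => Iff.rfl), (card_filter_congr fun _ _ => Iff.rfl).trans_le hω.2.2⟩
        · rw [DecisionTree.ind_of_not_mem hω]; exact DecisionTree.ind_nonneg _ _
      · exact mul_nonneg (Finset.prod_nonneg fun κ _ => hΘ0 κ) (Finset.prod_nonneg fun κ _ => huu0 κ)
    · refine Finset.sum_congr rfl fun I _ => ?_
      simp only [hcfF, hΘ]
      congr 1
  -- assemble
  rw [hlonelySum]
  have hchords : ∑ K : Fin Mc, W {Fin.natAdd Mf K} * DecisionTree.ind (D₂ {Fin.natAdd Mf K}) ω ≤ ∑ K, D K * ∑ S ∈ PS, W S * DecisionTree.ind (ℓ K S) ω :=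
    Finset.sum_le_sum fun K _ => hpay K
  linarith

end StarSet

end Summit.CriticalPhenomena.PercolationContinuityZ3.Theorems

end
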